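import Literature.Computability.QuantumComplexity.ShiftedCleanBlockDesc
import Literature.Computability.QuantumComplexity.UniformAbstract
import Literature.Computability.QuantumComplexity.StageAbstract
import HarnessLib

/-!
# Generator descriptions and abstract gate lists: `opBits` is the raw code of `progA`

Topic `Computability/QuantumComplexity` (trunk shared by the uniformity proofs), a bridge between the two uniformity
currencies of the library:

* the GENERATOR-PROGRAM currency (`RevTableauUniform.lean`, `CleanBlockDesc.lean`, `ShiftedCleanBlockDesc.lean`, …):
  a family's description is PRINTED, `1ᵘ ↦ ops(u).flatMap opBits ∈ FP`, where `opBits op` are the description bits of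
  the Clifford+T word of the reversible gate `op`;
* the ABSTRACT-GATE-LIST currency (`CoreDescBlockFP.lean`, `AbstractGateUniform.lean`, `StageAbstract.lean`, …):
  `CodeFP unE (rawE agE0) circA` for the abstract word `circA = gates.map toAG`, composed by the typed `CodeFP` algebra.

The bridge: for every list of reversible gates, **`flatMap_opBits_eq_rawE`**:
`ops.flatMap opBits = rawE agE (progA ops)` (both are the concatenation of the doubled gate codes followed by `01`;
`AGate.bits_eq` for a gate symbol with the right number of wires, `RevDesc.rawE_eq_flatMap`). Hence a printed
description is an abstract word on codes (**`codeFP_progA_of_mem_FP`**), and in particular the compute–copy–uncompute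
block of Bennett's trick with empty suffix, shifted or not, is an abstract word on codes from its unary size
(**`RevClean.cleanWordA_codeFP`**, **`RevClean.cleanWordA_codeFP_id`**) — the input the Regev sampler's classical blocks
need (`CleanXor.map_toAG_circuit'`, `RevClean.cleanOps_eq_notsV_append` in `CleanXorAbstract.lean`).

Everything is proved; no named fact is introduced.

## References

* S. Arora, B. Barak, *Computational Complexity: A Modern Approach*, CUP 2009, §6.1 (circuit descriptions), §6.2
  Def. 6.12 and Remark 6.7 (descriptions printed in polynomial time) [AroraBarak2009].
* C. H. Bennett, *Logical reversibility of computation*, IBM J. Res. Dev. 17 (1973), §2 [Bennett1973].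
-/

noncomputable section

namespace Literature.Computability.QuantumComplexity

open _root_.Computability Complexity Complexity.CodeFP Cryptography RevDesc AJLCore
open Complexity.SProg (dbl dbl_nil dbl_cons)

/-! ### The raw list code is the concatenation of the doubled cells -/

/-- The raw list code, cell by cell: `rawE e l = l.flatMap (a ↦ dbl (e a) ++ 01)`. [cite: AroraBarak2009, §6.1] -/
theorem RevDesc.rawE_eq_flatMap {α : Type} (e : α → List Bool) (l : List α) :
    rawE e l = l.flatMap fun a => dbl (e a) ++ [false, true] := by
  induction l with
  | nil => rfl
  | cons a l ih =>
    rw [List.flatMap_cons, ← ih]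
    show boolPair (e a) (rawE e l) = _
    rw [boolPair_eq]

/-- The wires of the abstract gates of a compiled reversible gate have the arity of their symbol. [folklore] -/
theorem RevDesc.length_wires_of_mem_agates (op : ClOp ℕ) : ∀ a ∈ agates op, a.wires.length = symArity a.sym := by
  cases op <;> simp [agates, symArity]

/-- The doubled cells of binary numerals are the wire codes. [folklore] -/
theorem RevDesc.dbl_flatMap_cell (ws : List ℕ) :
    dbl (ws.flatMap fun a => dbl (natE a) ++ [false, true]) = ws.flatMap wireBits := by
  induction ws with
  | nil => rfl
  | cons w ws ih =>
    rw [List.flatMap_cons, dbl_append, ih, List.flatMap_cons, wireBits, dbl_append, ← dbl_dbl_encodeNat]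
    rfl

/-- **The description bits of an abstract gate with the right number of wires are its doubled code and `01`.**
[cite: AroraBarak2009, §6.1] -/
theorem RevDesc.AGate.bits_eq (a : AG) (h : a.wires.length = symArity a.sym) :
    a.bits = dbl (agE a) ++ [false, true] := by
  obtain ⟨s, ws⟩ := a
  simp only at h
  simp only [AGate.bits, gateBits, gatePre, agE, listE]
  rw [boolPair_eq, boolPair_eq, ← h, rawE_eq_flatMap]
  simp only [dbl_cons, dbl_append, dbl_flatMap_cell, unE_eq_ones, ones, dbl_replicate, List.append_assoc,
    List.cons_append, List.nil_append]
  rw [show 2 * (2 * ws.length) = 4 * ws.length by ring]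

/-- **The printed description of a reversible program is the raw code of its abstract word.**
[cite: AroraBarak2009, §6.1, §6.2 Remark 6.7] -/
theorem RevDesc.flatMap_opBits_eq_rawE (ops : List (ClOp ℕ)) : ops.flatMap opBits = rawE agE (progA ops) := by
  have hcongr : ∀ {α β : Type} (l : List α) (f g : α → List β), (∀ a ∈ l, f a = g a) → l.flatMap f = l.flatMap g := by
    intro α β l f g h
    induction l with
    | nil => rfl
    | cons a l ih =>
      rw [List.flatMap_cons, List.flatMap_cons, h a (by simp), ih fun b hb => h b (by simp [hb])]
  induction ops with
  | nil => rfl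
  | cons op ops ih =>
    rw [List.flatMap_cons, show progA (op :: ops) = agates op ++ progA ops from List.flatMap_cons, rawE_append, ← ih,
      opBits, rawE_eq_flatMap, hcongr (agates op) AGate.bits (fun a => dbl (agE a) ++ [false, true])
        fun a ha => AGate.bits_eq a (length_wires_of_mem_agates op a ha)]

/-- The same in the working code `agE0` of the `CodeFP` lemmas. [folklore] -/
theorem RevDesc.opBits_progA_codeFP : CodeFP (fun ops : List (ClOp ℕ) => ops.flatMap opBits) (rawE agE0) progA :=
  ((map₀ agE0_of_agE).comp (transparent (eα := fun ops : List (ClOp ℕ) => ops.flatMap opBits) (eβ := rawE agE)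
    (g := progA) fun ops => (flatMap_opBits_eq_rawE ops).symm)).congr fun _ => List.map_id _

/-- **A printed description is an abstract word on codes**: if `F ∈ FP` prints `ops(|z|).flatMap opBits` on every
input `z`, then `1ᵘ ↦ progA (ops u)` is computed on codes. [cite: AroraBarak2009, §6.2 Remark 6.7] -/
theorem RevDesc.codeFP_progA_of_mem_FP {ops : ℕ → List (ClOp ℕ)} {F : List Bool → List Bool} (hF : F ∈ FP)
    (h : ∀ z, F z = (ops z.length).flatMap opBits) : CodeFP unE (rawE agE0) (fun u => progA (ops u)) := by
  have h1 : CodeFP unE (rawE agE) (fun u => progA (ops u)) :=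
    ⟨F, hF, fun u => by rw [h, length_unE, flatMap_opBits_eq_rawE]⟩
  exact ((map₀ agE0_of_agE).comp h1).congr fun _ => List.map_id _

namespace RevClean

open Turing RevSim

variable {e : ℕ} {M : TM2ComputableAux Bool Bool}

/-- **The shifted clean block with empty suffix is an abstract word on codes** (from `1ᵘ`; data length `N(u)` and
shift `S(u)` generator expressions in `u`). [cite: Bennett1973, §2] [cite: AroraBarak2009, §6.2 Remark 6.7] -/
theorem cleanWordA_codeFP {S NE : GE} (hS : InUU S) (hNE : InUU NE) :
    CodeFP unE (rawE agE0) (fun u => progA ((cleanOps e M (NE.eval (envU u)) []).map (ClOp.map (· + S.eval (envU u))))) :=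
  codeFP_progA_of_mem_FP (flatMap_opBits_cleanOps_shift_mem_FP (e := e) (M := M) hS hNE) fun _ => rfl

/-- Re-indexing by the identity. [folklore] -/
theorem _root_.Literature.Computability.QuantumComplexity.ClOp.map_id' {α : Type} (op : ClOp α) :
    op.map (fun i => i) = op := by
  cases op <;> rfl

/-- **The clean block with empty suffix, unshifted, is an abstract word on codes from its unary data length.**
[cite: Bennett1973, §2] [cite: AroraBarak2009, §6.2 Remark 6.7] -/
theorem cleanWordA_codeFP_id : CodeFP unE (rawE agE0) (fun u => progA (cleanOps e M u [])) := by
  have hvar : InUU (.var .uu : GE) := fun x hx => by simpa [GExpr.fv] using hx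
  have hzero : InUU (.const 0 : GE) := fun x hx => by simp [GExpr.fv] at hx
  refine (cleanWordA_codeFP (e := e) (M := M) hzero hvar).congr fun u => ?_
  have hu : (GExpr.var GV.uu : GE).eval (envU u) = u := by simp [GExpr.eval, envU, GenProg.initEnv]
  have h0 : (GExpr.const 0 : GE).eval (envU u) = 0 := by simp [GExpr.eval]
  rw [hu, h0]
  congr 1
  conv_rhs => rw [← List.map_id (cleanOps e M u [])]
  refine List.map_congr_left fun op _ => ?_
  rw [show (fun i : ℕ => i + 0) = fun i => i from funext fun i => Nat.add_zero i]
  exact op.map_id'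

/-- **With the abstract-word algebra**: the relabelled clean block of `CleanXor.map_toAG_circuit'` is, for an empty
suffix, `(progA (cleanOps e M N [])).map (AGmap f)`, so it is computed on codes as soon as `f` is
(`AJLCore.mapAGmap_codeFP`) — recorded as the composition lemma. [cite: AroraBarak2009, §6.2] -/
theorem cleanWordA_map_codeFP {σ : Type} {eσ : σ → List Bool} {N : σ → ℕ} {f : σ → ℕ → ℕ} (hN : CodeFP eσ unE N)
    (hf : CodeFP (pairE eσ natE) natE (fun q => f q.1 q.2)) :
    CodeFP eσ (rawE agE0) (fun c => (progA (cleanOps e M (N c) [])).map (AGmap (f c))) :=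
  ((mapAGmap_codeFP hf).comp ((CodeFP.id _).pair ((cleanWordA_codeFP_id (e := e) (M := M)).comp hN))).congr fun _ => rfl

end RevClean

end Literature.Computability.QuantumComplexity

end
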